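import Summits.BirchSwinnertonDyer.BirchSwinnertonDyer.Theorems.UniversalToricDescentToricTransportModThreeNormProfile
import Summits.BirchSwinnertonDyer.BirchSwinnertonDyer.Theses.UniversalToricDescent
import Summits.BirchSwinnertonDyer.Rank1Residual.X11b.UnrIntegersValuationRing
import Literature.NumberTheory.LFunctions.DworkRationalitySplittingSeries
import HarnessLib

/-!
# Route `UniversalToricDescent` — act D's Flat glue `ToricTransportModThreeFlatGlue`
# (item stmt-BirchSwinnertonDyer-26044) HOLDS: `DefectTransportModThree → (wall ∧ twin μ = 0) → ToricTransportModThreeFlat`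

Cell `bsd-wall` (W-ALL lane 3, row 2·3@3), seat `bsd-wall-utd-p1` g11 executing the UTD pen's act-D prover
ticket (β) (planner pss3x g3, PLAN-D.md D3; route rev 39 renders ♭T `DefectTransportModThree` (26042), the package
`ToricWallAndTwinMuAtThree` (26043) and the glue (26044)). The proof is the CROSS-SQUEEZE of utd-idea g15's
sketch (§3, `Sketch-utd-idea-g15.lean` l.398) as certified by vet bsd-vet-tk5d g7 (`Combined_actD_g7.lean`
sha16 b92d6ed8e641ae64, §1 + §3 + (C2), rc 0, std axioms), landed by a prover as the gate requires:

* §1 power-series algebra over `R₀ = unrIntegers p` (general `p`): first-unit indices are monotone under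
  divisibility (`firstUnitCoeff_le_of_dvd`); `3^k · G ∈ (L)` with `μ(L) = 0` forces `L ∣ G`
  (`dvd_of_mem_of_C_pow_mul_mem_span`, via `C(p) ∣ F·H ∧ μ(F) = 0 ⇒ C(p) ∣ H`);
* §2 `toricTransportModThreeFlat_of_wall_of_defect_of_mu` — at the `E`-frame `L` the wall gives `(L) ⊆ (g_E)`, so
  `n ≤ m`; at the handed twin frame the rational Wan clause and `μ(L′) = 0` give `L′ ∣ g′`, so `m′ ≤ n′`; the defect
  identity `n + m′ = n′ + m` closes the squeeze (`n = m`), and `eq_span_of_span_le_of_normProfile` (p531417) turns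
  `(L) ⊆ (g_E)` + equal profiles into `Ch(E)·R₀⟦T⟧ = (L)`; bonus `twinIMC_of_wall_of_defect_of_mu`: the twin's
  own IMC equality at the handed frame (`n′ = m′`);
* **`toricTransportModThreeFlatGlue_proof`** — the glue item, literally the route decl.

CONDITIONAL on the displayed hypotheses (♭T is conjecture-grade research, the wall 20395 is THE WALL, 20400 is
print modulo Hsieh any-level); closes nothing but the glue; BSD is not proved by any of this.
-/

noncomputable section

open scoped Classical

set_option linter.dupNamespace false
set_option autoImplicit false

namespace Summit.BirchSwinnertonDyer.BirchSwinnertonDyer.Theorems.UniversalToricDescentActDFlatGlue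

open WeierstrassCurve NumberField IsDedekindDomain Field
  Literature.NumberTheory.EllipticCurves
  Literature.NumberTheory.EllipticCurves.ModularForms
  Literature.NumberTheory.EllipticCurves.Rank1Residual
  Summit.BirchSwinnertonDyer.Rank1Residual
  Summit.BirchSwinnertonDyer.Rank1Residual.Additive
  Summit.BirchSwinnertonDyer.Rank1Residual.X11b
  Summit.BirchSwinnertonDyer.Rank1Residual.X11b.AcSelmer
  Summit.BirchSwinnertonDyer.Rank1Residual.X11b.Halves
  Summit.BirchSwinnertonDyer.BirchSwinnertonDyer.Theses.UniversalToricDescent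
  Summit.BirchSwinnertonDyer.BirchSwinnertonDyer.Theorems
  Summit.BirchSwinnertonDyer.BirchSwinnertonDyer.Theorems.UniversalToricDescentNormProfile

/-! ### §1 Power-series algebra over `R₀ = unrIntegers p` (general `p`) -/

section Algebra

variable {p : ℕ} [hp : Fact p.Prime]

/-- Ultrametric: a finite sum of terms of norm `< r` (`0 < r`) has norm `< r`. [folklore] -/
theorem norm_sum_lt_of_forall_lt {ι : Type*} {s : Finset ι} {F : ι → ℂ_[p]} {r : ℝ} (hr : 0 < r)
    (h : ∀ i ∈ s, ‖F i‖ < r) : ‖∑ i ∈ s, F i‖ < r := by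
  rcases s.eq_empty_or_nonempty with rfl | hne
  · simpa using hr
  · obtain ⟨i, hi, hle⟩ := IsUltrametricDist.exists_norm_finsetSum_le_of_nonempty hne F
    exact lt_of_le_of_lt hle (h i hi)

/-- **First unit coefficient is monotone under divisibility.** If `F ∣ G`, `F` has no coefficient of norm `1`
below degree `a`, and `‖G_b‖ = 1`, then `a ≤ b` (the degree-`b` coefficient of `F·H` with `b < a` is a sum of
terms `F_i H_j`, `i < a`, all of norm `< 1`). With `μ = 0` this is `λ(F) ≤ λ(G)`. [folklore] -/
theorem firstUnitCoeff_le_of_dvd {F G : UnrSeries p} {a b : ℕ} (h : F ∣ G)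
    (hF : ∀ i < a, ‖((PowerSeries.coeff i F : unrIntegers p) : ℂ_[p])‖ < 1)
    (hG : ‖((PowerSeries.coeff b G : unrIntegers p) : ℂ_[p])‖ = 1) : a ≤ b := by
  by_contra hlt
  push Not at hlt
  obtain ⟨H, rfl⟩ := h
  let T : ℕ × ℕ → ℂ_[p] := fun ij ↦
    ((PowerSeries.coeff ij.1 F * PowerSeries.coeff ij.2 H : unrIntegers p) : ℂ_[p])
  have hterm : ∀ ij ∈ Finset.HasAntidiagonal.antidiagonal b, ‖T ij‖ < 1 := by
    intro ij hij
    rw [Finset.HasAntidiagonal.mem_antidiagonal] at hij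
    simp only [T, Subring.coe_mul, norm_mul]
    calc ‖((PowerSeries.coeff ij.1 F : unrIntegers p) : ℂ_[p])‖ *
          ‖((PowerSeries.coeff ij.2 H : unrIntegers p) : ℂ_[p])‖
        ≤ ‖((PowerSeries.coeff ij.1 F : unrIntegers p) : ℂ_[p])‖ * 1 :=
          mul_le_mul_of_nonneg_left (norm_coeff_le_one H _) (norm_nonneg _)
      _ < 1 := by rw [mul_one]; exact hF _ (by omega)
  have hcoe : ((PowerSeries.coeff b (F * H) : unrIntegers p) : ℂ_[p]) =
      ∑ ij ∈ Finset.HasAntidiagonal.antidiagonal b, T ij := by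
    rw [PowerSeries.coeff_mul]; exact map_sum (unrIntegers p).subtype _ _
  have hsum : ‖((PowerSeries.coeff b (F * H) : unrIntegers p) : ℂ_[p])‖ < 1 := by
    rw [hcoe]; exact norm_sum_lt_of_forall_lt one_pos hterm
  exact absurd hG (ne_of_lt hsum)

/-- The coefficients of a multiple of the constant `p` have norm `< 1`. [folklore] -/
theorem norm_coeff_lt_one_of_C_dvd {H : UnrSeries p} (h : PowerSeries.C ((p : ℕ) : unrIntegers p) ∣ H)
    (j : ℕ) : ‖((PowerSeries.coeff j H : unrIntegers p) : ℂ_[p])‖ < 1 := by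
  obtain ⟨Q, rfl⟩ := h
  have hp' : p.Prime := hp.out
  rw [PowerSeries.coeff_C_mul, Subring.coe_mul, norm_mul]
  have hcast : (((p : ℕ) : unrIntegers p) : ℂ_[p]) = (p : ℂ_[p]) := by simp
  rw [hcast, Literature.NumberTheory.LFunctions.Dwork.norm_natCast_p_padicComplex]
  calc (p : ℝ)⁻¹ * ‖((PowerSeries.coeff j Q : unrIntegers p) : ℂ_[p])‖ ≤ (p : ℝ)⁻¹ * 1 :=
        mul_le_mul_of_nonneg_left (norm_coeff_le_one Q j) (inv_nonneg.mpr (Nat.cast_nonneg p))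
    _ < 1 := by rw [mul_one]; exact inv_lt_one_of_one_lt₀ (by exact_mod_cast hp'.one_lt)

/-- A series all of whose coefficients have norm `< 1` is a multiple of the constant `p` (the value group of
`R₀ = 𝓞_{ℚ_p^{nr}}^∧` is `p^ℤ`: `‖x‖ < 1 ⇒ ‖x‖ ≤ p⁻¹ ⇒ x/p ∈ R₀`). [folklore] -/
theorem C_dvd_of_forall_norm_coeff_lt_one {H : UnrSeries p}
    (h : ∀ j, ‖((PowerSeries.coeff j H : unrIntegers p) : ℂ_[p])‖ < 1) :
    PowerSeries.C ((p : ℕ) : unrIntegers p) ∣ H := by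
  have hp' : p.Prime := hp.out
  have hmem : ∀ j, ((PowerSeries.coeff j H : unrIntegers p) : ℂ_[p]) / (p : ℂ_[p]) ∈ unrIntegers p := by
    intro j
    have hle : ‖((PowerSeries.coeff j H : unrIntegers p) : ℂ_[p])‖ ≤ ((p : ℝ)⁻¹) ^ 1 := by
      rw [pow_one]
      rcases eq_or_ne ((PowerSeries.coeff j H : unrIntegers p) : ℂ_[p]) 0 with h0 | h0
      · rw [h0, norm_zero]; exact inv_nonneg.mpr (Nat.cast_nonneg p)
      · obtain ⟨n, hn, -⟩ := R1.exists_norm_eq_inv_pow (PowerSeries.coeff j H).2 h0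
        have hn1 : 1 ≤ n := by
          by_contra hlt
          push Not at hlt
          have h0' : n = 0 := by omega
          rw [h0', pow_zero] at hn
          exact absurd hn (ne_of_lt (h j))
        rw [hn]
        calc ((p : ℝ)⁻¹) ^ n ≤ ((p : ℝ)⁻¹) ^ 1 :=
              pow_le_pow_of_le_one (inv_nonneg.mpr (Nat.cast_nonneg p))
                (inv_le_one_of_one_le₀ (by exact_mod_cast hp'.one_lt.le)) hn1
          _ = (p : ℝ)⁻¹ := pow_one _
    simpa [pow_one] using R1.div_pow_mem_unrIntegers (PowerSeries.coeff j H).2 hle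
  refine ⟨PowerSeries.mk fun j ↦ ⟨_, hmem j⟩, PowerSeries.ext fun j ↦ Subtype.ext ?_⟩
  have hcast : (((p : ℕ) : unrIntegers p) : ℂ_[p]) = (p : ℂ_[p]) := by simp
  have hp0 : (p : ℂ_[p]) ≠ 0 := by exact_mod_cast hp'.ne_zero
  rw [PowerSeries.coeff_C_mul, PowerSeries.coeff_mk, Subring.coe_mul, hcast]
  change ((PowerSeries.coeff j H : unrIntegers p) : ℂ_[p]) =
    (p : ℂ_[p]) * (((PowerSeries.coeff j H : unrIntegers p) : ℂ_[p]) / (p : ℂ_[p]))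
  rw [mul_div_cancel₀ _ hp0]

/-- **`p`-primality of a `μ = 0` series.** If `F` has a coefficient of norm `1` (first one in degree `a`) and
`C p ∣ F·H`, then `C p ∣ H`: by strong induction every `‖H_j‖ < 1`, since in degree `a + j` the term `F_a H_j`
would otherwise dominate ultrametrically a coefficient of `p·Q`. [folklore] -/
theorem C_dvd_of_C_dvd_mul {F H : UnrSeries p} {a : ℕ}
    (hF : ∀ i < a, ‖((PowerSeries.coeff i F : unrIntegers p) : ℂ_[p])‖ < 1)
    (hFa : ‖((PowerSeries.coeff a F : unrIntegers p) : ℂ_[p])‖ = 1)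
    (h : PowerSeries.C ((p : ℕ) : unrIntegers p) ∣ F * H) :
    PowerSeries.C ((p : ℕ) : unrIntegers p) ∣ H := by
  apply C_dvd_of_forall_norm_coeff_lt_one
  intro j
  induction j using Nat.strong_induction_on with
  | _ j ih =>
  by_contra hj
  have hj1 : ‖((PowerSeries.coeff j H : unrIntegers p) : ℂ_[p])‖ = 1 :=
    le_antisymm (norm_coeff_le_one H j) (not_lt.mp hj)
  let T : ℕ × ℕ → ℂ_[p] := fun il ↦
    ((PowerSeries.coeff il.1 F * PowerSeries.coeff il.2 H : unrIntegers p) : ℂ_[p])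
  have hmem : (a, j) ∈ Finset.HasAntidiagonal.antidiagonal (a + j) := by
    rw [Finset.HasAntidiagonal.mem_antidiagonal]
  have hsplit : ((PowerSeries.coeff (a + j) (F * H) : unrIntegers p) : ℂ_[p]) =
      T (a, j) + ∑ il ∈ (Finset.HasAntidiagonal.antidiagonal (a + j)).erase (a, j), T il := by
    rw [PowerSeries.coeff_mul, ← Finset.add_sum_erase _ _ hmem, Subring.coe_add]
    congr 1
    exact map_sum (unrIntegers p).subtype _ _
  have hmain : ‖T (a, j)‖ = 1 := by
    simp only [T, Subring.coe_mul, norm_mul, hFa, hj1, mul_one]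
  have hrest : ‖∑ il ∈ (Finset.HasAntidiagonal.antidiagonal (a + j)).erase (a, j), T il‖ < 1 := by
    apply norm_sum_lt_of_forall_lt one_pos
    intro il hil
    rw [Finset.mem_erase, Finset.HasAntidiagonal.mem_antidiagonal] at hil
    obtain ⟨hne, hsum⟩ := hil
    simp only [T, Subring.coe_mul, norm_mul]
    rcases lt_trichotomy il.1 a with hlt | heq | hgt
    · calc ‖((PowerSeries.coeff il.1 F : unrIntegers p) : ℂ_[p])‖ *
            ‖((PowerSeries.coeff il.2 H : unrIntegers p) : ℂ_[p])‖
          ≤ ‖((PowerSeries.coeff il.1 F : unrIntegers p) : ℂ_[p])‖ * 1 :=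
            mul_le_mul_of_nonneg_left (norm_coeff_le_one H _) (norm_nonneg _)
        _ < 1 := by rw [mul_one]; exact hF _ hlt
    · exact absurd (Prod.ext heq (by simp only at hsum ⊢; omega)) hne
    · have hl : il.2 < j := by omega
      calc ‖((PowerSeries.coeff il.1 F : unrIntegers p) : ℂ_[p])‖ *
            ‖((PowerSeries.coeff il.2 H : unrIntegers p) : ℂ_[p])‖
          ≤ 1 * ‖((PowerSeries.coeff il.2 H : unrIntegers p) : ℂ_[p])‖ :=
            mul_le_mul_of_nonneg_right (norm_coeff_le_one F _) (norm_nonneg _)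
        _ < 1 := by rw [one_mul]; exact ih _ hl
  have hnorm : ‖((PowerSeries.coeff (a + j) (F * H) : unrIntegers p) : ℂ_[p])‖ = 1 := by
    rw [hsplit, IsUltrametricDist.norm_add_eq_max_of_norm_ne_norm
      (by rw [hmain]; exact (ne_of_lt hrest).symm), hmain]
    exact max_eq_left hrest.le
  have hlt := norm_coeff_lt_one_of_C_dvd h (a + j)
  rw [hnorm] at hlt
  exact lt_irrefl _ hlt

/-- **Cancelling `p^k` against a `μ = 0` series**: if `F` has a coefficient of norm `1` and `F ∣ p^k · G`, then
`F ∣ G`. This turns a RATIONAL (`Λ ⊗ ℚ_p`) divisibility by a `μ = 0` series into an integral one. [folklore] -/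
theorem dvd_of_dvd_C_pow_mul {F G : UnrSeries p} {a : ℕ}
    (hF : ∀ i < a, ‖((PowerSeries.coeff i F : unrIntegers p) : ℂ_[p])‖ < 1)
    (hFa : ‖((PowerSeries.coeff a F : unrIntegers p) : ℂ_[p])‖ = 1) :
    ∀ k : ℕ, F ∣ PowerSeries.C (((p : ℕ) : unrIntegers p) ^ k) * G → F ∣ G := by
  intro k
  induction k with
  | zero => intro h; simpa using h
  | succ k ih =>
    intro h
    obtain ⟨H, hH⟩ := h
    have hCp : PowerSeries.C (((p : ℕ) : unrIntegers p) ^ (k + 1)) * G =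
        PowerSeries.C ((p : ℕ) : unrIntegers p) * (PowerSeries.C (((p : ℕ) : unrIntegers p) ^ k) * G) := by
      rw [pow_succ', map_mul, mul_assoc]
    have hdvd : PowerSeries.C ((p : ℕ) : unrIntegers p) ∣ F * H := ⟨_, by rw [← hH, hCp]⟩
    obtain ⟨H', rfl⟩ := C_dvd_of_C_dvd_mul hF hFa hdvd
    apply ih
    refine ⟨H', ?_⟩
    have hC0 : (PowerSeries.C ((p : ℕ) : unrIntegers p) : UnrSeries p) ≠ 0 := by
      intro h0
      have h1 := congrArg (fun f ↦ ((PowerSeries.constantCoeff f : unrIntegers p) : ℂ_[p])) h0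
      simp only [PowerSeries.constantCoeff_C, map_zero, ZeroMemClass.coe_zero] at h1
      have h2 : (((p : ℕ) : unrIntegers p) : ℂ_[p]) = (p : ℂ_[p]) := by simp
      rw [h2] at h1
      exact hp.out.ne_zero (by exact_mod_cast h1)
    apply mul_left_cancel₀ hC0
    rw [← hCp, hH]; ring

/-- The rational Wan clause (`∃ k, p^k · I ⊆ (L)`) together with `μ(L) = 0` gives the INTEGRAL divisibility
`L ∣ g` for every `g ∈ I`. [folklore] -/
theorem dvd_of_mem_of_C_pow_mul_mem_span {I : Ideal (UnrSeries p)} {L g : UnrSeries p} {a : ℕ}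
    (hL : ∀ i < a, ‖((PowerSeries.coeff i L : unrIntegers p) : ℂ_[p])‖ < 1)
    (hLa : ‖((PowerSeries.coeff a L : unrIntegers p) : ℂ_[p])‖ = 1)
    (hk : ∃ k : ℕ, ∀ G ∈ I, PowerSeries.C (((p : ℕ) : unrIntegers p) ^ k) * G ∈ Ideal.span {L})
    (hg : g ∈ I) : L ∣ g := by
  obtain ⟨k, hk⟩ := hk
  exact dvd_of_dvd_C_pow_mul hL hLa k (Ideal.mem_span_singleton.mp (hk g hg))

/-- A UNIT frame satisfies the rational Wan clause for every ideal, with `k = 0`. [folklore] -/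
theorem wanClause_of_isUnit {L : UnrSeries p} (hL : IsUnit L) (I : Ideal (UnrSeries p)) :
    ∃ k : ℕ, ∀ G ∈ I, PowerSeries.C (((p : ℕ) : unrIntegers p) ^ k) * G ∈ Ideal.span {L} := by
  refine ⟨0, fun G _ ↦ ?_⟩
  rw [Ideal.span_singleton_eq_top.mpr hL]
  exact Submodule.mem_top

/-- A frame with `‖L(0)‖ = 1` is a unit of `R₀⟦T⟧`, hence satisfies the rational Wan clause. [folklore] -/
theorem wanClause_of_norm_constantCoeff_eq_one {L : UnrSeries p}
    (hL : ‖((PowerSeries.constantCoeff L : unrIntegers p) : ℂ_[p])‖ = 1) (I : Ideal (UnrSeries p)) :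
    ∃ k : ℕ, ∀ G ∈ I, PowerSeries.C (((p : ℕ) : unrIntegers p) ^ k) * G ∈ Ideal.span {L} :=
  wanClause_of_isUnit
    (PowerSeries.isUnit_iff_constantCoeff.mpr ((unrIntegers.isUnit_iff_norm_eq_one _).mpr hL)) I

end Algebra

/-! ### §2 The cross-squeeze: glue♭ -/

/-- **The cross-squeeze.** `n ≤ m` (wall: `g ∣ L`), `m′ ≤ n′` (♭-twin: `L′ ∣ g′`), `n + m′ = n′ + m` (defect
transport) force `n = m` and `n′ = m′`. [folklore] -/
theorem squeeze {n m n' m' : ℕ} (h₁ : n ≤ m) (h₂ : m' ≤ n') (h₃ : n + m' = n' + m) : n = m ∧ n' = m' := by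
  omega

/-- **Glue♭: wall 20395 + defect transport #2b♭ + twin `μ = 0` (20400) ⇒ #2♭.** At the `E`-frame `L`: the wall
gives `(L) ⊆ (g_E)`, so `λ(g_E) ≤ λ(L)` (`firstUnitCoeff_le_of_dvd`); at the handed twin frame `L′`: the rational
Wan clause and `μ(L′) = 0` give `L′ ∣ g′` (`dvd_of_mem_of_C_pow_mul_mem_span`), so `λ(L′) ≤ λ(g′)`; the defect
identity closes the squeeze, and `eq_span_of_span_le_of_normProfile` (p531417) turns `(L) ⊆ (g_E)` + equal
profiles into `Ch(E)·R₀⟦T⟧ = (L)`. CONDITIONAL on the three displayed hypotheses; closes nothing by itself.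
[folklore] -/
theorem toricTransportModThreeFlat_of_wall_of_defect_of_mu
    (hwall : AdditiveSplitIMCInclusionAtThree) (hD : DefectTransportModThree) (hmu : TwinMuZeroAtThree) :
    ToricTransportModThreeFlat := by
  intro W _ _ W' _ _ N N' _ _ K _ _ Dt Dt' hO6 hsurj hr hN hcong hss hN' hK hHN hHN' κ hκ γ _ 𝔭 h𝔭 he hf
    𝔭' h𝔭' hne ι' hind htors hwan ΩK Ωp L hΩK hΩp hBDP
  -- the wall at `E`: `(L) ⊆ Ch(E)·R₀⟦T⟧`
  have hle : Ideal.span {L} ≤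
      (XAc.charIdeal (W.baseChange K) 3 κ 𝔭' ∅ γ).map (PowerSeries.map (toUnr 3)) :=
    hwall W N K Dt hO6 hsurj hr hN hK hHN κ hκ γ 𝔭 h𝔭 he hf 𝔭' h𝔭' hne ι' hind ΩK Ωp L hΩK hΩp hBDP
  -- twin frames have `μ = 0`
  have hμ' : ∀ (ΩK : ℂ) (Ωp : ℂ_[3]) (L' : UnrSeries 3), ΩK ≠ 0 → Ωp ≠ 0 →
      IsBDPLFunction ι' 𝔭 κ γ Dt'.f ΩK Ωp L' →
      ∃ i : ℕ, ‖((PowerSeries.coeff i L' : unrIntegers 3) : ℂ_[3])‖ = 1 :=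
    fun ΩK Ωp L' hΩK hΩp hBDP' ↦ hmu W W' N N' K Dt Dt' hO6 hsurj hr hN hcong hss hN' hK hHN hHN' κ hκ γ 𝔭
      h𝔭 he hf 𝔭' h𝔭' hne ι' hind ΩK Ωp L' hΩK hΩp hBDP'
  -- the handed twin frame with its rational Wan clause
  obtain ⟨ΩK', Ωp', L', hΩK', hΩp', hBDP', hk⟩ := hwan
  -- defect transport: the four profiles
  obtain ⟨g, g', n, m, n', m', hIE, hI', hg, hL, hg', hL', hsum⟩ :=
    hD W W' N N' K Dt Dt' hO6 hsurj hr hN hcong hss hN' hK hHN hHN' κ hκ γ 𝔭 h𝔭 he hf 𝔭' h𝔭' hne ι' hind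
      htors hμ' ΩK Ωp L hΩK hΩp hBDP hle ΩK' Ωp' L' hΩK' hΩp' hBDP'
  -- `n ≤ m`: `g ∣ L` from the wall
  have hgL : g ∣ L := by
    rw [hIE] at hle
    exact Ideal.mem_span_singleton.mp (hle (Ideal.mem_span_singleton_self L))
  have h₁ : n ≤ m := firstUnitCoeff_le_of_dvd hgL hg.1 hL.2
  -- `m′ ≤ n′`: `L′ ∣ g′` from the rational Wan clause and `μ(L′) = 0`
  have hL'g' : L' ∣ g' :=
    dvd_of_mem_of_C_pow_mul_mem_span hL'.1 hL'.2 hk (hI' ▸ Ideal.mem_span_singleton_self g')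
  have h₂ : m' ≤ n' := firstUnitCoeff_le_of_dvd hL'g' hL'.1 hg'.2
  -- squeeze and close
  obtain ⟨hnm, -⟩ := squeeze h₁ h₂ hsum
  subst hnm
  exact eq_span_of_span_le_of_normProfile hIE hle hg.1 hL.2

/-- **Bonus: the twin's OWN IMC equality at the handed frame** falls out of the same squeeze (`n′ = m′`,
`L′ ∣ g′`, `span_eq_span_of_dvd_of_normProfile`). Displayed for the record: under wall + defect transport + twin
`μ = 0`, a ♭-twin frame `L′` with `3^k Ch(W′) ⊆ (L′)` has `Ch(W′)·R₀⟦T⟧ = (L′)` as soon as ONE `E`-frame exists in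
the class. CONDITIONAL; closes nothing. [folklore] -/
theorem twinIMC_of_wall_of_defect_of_mu
    (hwall : AdditiveSplitIMCInclusionAtThree) (hD : DefectTransportModThree) (hmu : TwinMuZeroAtThree) :
    ∀ (W : WeierstrassCurve ℚ) [W.IsElliptic] [W.IsGloballyMinimal] (W' : WeierstrassCurve ℚ) [W'.IsElliptic]
      [W'.IsGloballyMinimal] (N N' : ℕ) [NeZero N] [NeZero N'] (K : Type) [Field K] [NumberField K]
      (Dt : ModularParametrizationData W N) (Dt' : ModularParametrizationData W' N'),
      Additive.ClassO6 W 3 → W.HasSurjectiveModNGaloisRep 3 → W.analyticRank = 1 → W.conductorNorm ℤ = N →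
      O6.ModPCongruent W' W 3 → ¬ Addv W' 3 → W'.conductorNorm ℤ = N' → IsImaginaryQuadratic K →
      SatisfiesHeegnerHypothesis N K → SatisfiesHeegnerHypothesis N' K →
      ∀ (κ : ZpExtension K 3), κ.IsAnticyclotomic →
      ∀ (γ : absoluteGaloisGroup K) [Fact (κ.IsTopGenerator γ)] (𝔭 : HeightOneSpectrum (𝓞 K)),
        ((3 : ℕ) : 𝓞 K) ∈ 𝔭.asIdeal → 𝔭.asIdeal.ramificationIdx (𝓞 ℚ) = 1 →
        𝔭.asIdeal.inertiaDeg (𝓞 ℚ) = 1 →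
      ∀ (𝔭' : HeightOneSpectrum (𝓞 K)), ((3 : ℕ) : 𝓞 K) ∈ 𝔭'.asIdeal → 𝔭' ≠ 𝔭 →
      ∀ (ι' : PadicAlgCl 3 ≃+* ℂ), SchneiderFree.BranchInducesPrime 3 ι' 𝔭 →
        Module.IsTorsion (IwasawaAlgebra 3) (XAc (W.baseChange K) 3 κ 𝔭' ∅ γ) →
        (∃ (ΩK : ℂ) (Ωp : ℂ_[3]) (L : UnrSeries 3), ΩK ≠ 0 ∧ Ωp ≠ 0 ∧ IsBDPLFunction ι' 𝔭 κ γ Dt.f ΩK Ωp L) →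
        ∀ (ΩK' : ℂ) (Ωp' : ℂ_[3]) (L' : UnrSeries 3), ΩK' ≠ 0 → Ωp' ≠ 0 →
          IsBDPLFunction ι' 𝔭 κ γ Dt'.f ΩK' Ωp' L' →
          (∃ k : ℕ, ∀ G ∈ (XAc.charIdeal (W'.baseChange K) 3 κ 𝔭' ∅ γ).map (PowerSeries.map (toUnr 3)),
            PowerSeries.C (((3 : ℕ) : unrIntegers 3) ^ k) * G ∈ Ideal.span {L'}) →
          (XAc.charIdeal (W'.baseChange K) 3 κ 𝔭' ∅ γ).map (PowerSeries.map (toUnr 3)) = Ideal.span {L'} := by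
  intro W _ _ W' _ _ N N' _ _ K _ _ Dt Dt' hO6 hsurj hr hN hcong hss hN' hK hHN hHN' κ hκ γ _ 𝔭 h𝔭 he hf
    𝔭' h𝔭' hne ι' hind htors hex ΩK' Ωp' L' hΩK' hΩp' hBDP' hk
  obtain ⟨ΩK, Ωp, L, hΩK, hΩp, hBDP⟩ := hex
  have hle : Ideal.span {L} ≤
      (XAc.charIdeal (W.baseChange K) 3 κ 𝔭' ∅ γ).map (PowerSeries.map (toUnr 3)) :=
    hwall W N K Dt hO6 hsurj hr hN hK hHN κ hκ γ 𝔭 h𝔭 he hf 𝔭' h𝔭' hne ι' hind ΩK Ωp L hΩK hΩp hBDP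
  have hμ' : ∀ (ΩK : ℂ) (Ωp : ℂ_[3]) (L' : UnrSeries 3), ΩK ≠ 0 → Ωp ≠ 0 →
      IsBDPLFunction ι' 𝔭 κ γ Dt'.f ΩK Ωp L' →
      ∃ i : ℕ, ‖((PowerSeries.coeff i L' : unrIntegers 3) : ℂ_[3])‖ = 1 :=
    fun ΩK Ωp L' hΩK hΩp hBDP' ↦ hmu W W' N N' K Dt Dt' hO6 hsurj hr hN hcong hss hN' hK hHN hHN' κ hκ γ 𝔭
      h𝔭 he hf 𝔭' h𝔭' hne ι' hind ΩK Ωp L' hΩK hΩp hBDP'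
  obtain ⟨g, g', n, m, n', m', hIE, hI', hg, hL, hg', hL', hsum⟩ :=
    hD W W' N N' K Dt Dt' hO6 hsurj hr hN hcong hss hN' hK hHN hHN' κ hκ γ 𝔭 h𝔭 he hf 𝔭' h𝔭' hne ι' hind
      htors hμ' ΩK Ωp L hΩK hΩp hBDP hle ΩK' Ωp' L' hΩK' hΩp' hBDP'
  have hgL : g ∣ L := by
    rw [hIE] at hle
    exact Ideal.mem_span_singleton.mp (hle (Ideal.mem_span_singleton_self L))
  have h₁ : n ≤ m := firstUnitCoeff_le_of_dvd hgL hg.1 hL.2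
  have hL'g' : L' ∣ g' :=
    dvd_of_mem_of_C_pow_mul_mem_span hL'.1 hL'.2 hk (hI' ▸ Ideal.mem_span_singleton_self g')
  have h₂ : m' ≤ n' := firstUnitCoeff_le_of_dvd hL'g' hL'.1 hg'.2
  obtain ⟨-, hnm'⟩ := squeeze h₁ h₂ hsum
  subst hnm'
  rw [hI']
  exact (span_eq_span_of_dvd_of_normProfile hL'g' hL'.1 hg'.2).symm

/-! ### §3 The glue item -/

/-- **Act D's Flat glue `ToricTransportModThreeFlatGlue` (stmt-BirchSwinnertonDyer-26044) holds**:
`DefectTransportModThree → ToricWallAndTwinMuAtThree → ToricTransportModThreeFlat`, the package being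
`AdditiveSplitIMCInclusionAtThree ∧ TwinMuZeroAtThree` by definition (vet tk5d g7 (C2)). The type is literally the
route decl. [folklore] -/
theorem toricTransportModThreeFlatGlue_proof :
    Summit.BirchSwinnertonDyer.BirchSwinnertonDyer.Theses.UniversalToricDescent.ToricTransportModThreeFlatGlue :=
  fun hD h ↦ toricTransportModThreeFlat_of_wall_of_defect_of_mu h.1 hD h.2

end Summit.BirchSwinnertonDyer.BirchSwinnertonDyer.Theorems.UniversalToricDescentActDFlatGlue

end
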